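import Mathlib

/-!
# Nodal–Prym tangent rank, ℚ(i) family (m = 4), rung s = 3: the signed-product Vandermonde

W3 (pub-hsemireg widening, special fibres), pen note `W3-M4DROP-READ-w3prym1.md` v1.2 §3ter
(w3-prym-1 g9); second proof of the identity of `W3-M4DROP-w3prym2.md` v1.2 §3‴ (w3-prym-2 g8).
In the dual model of the nodal–Prym tangent span at `s = 3` (annihilator of the Hankel matrices
and of the node `E` = polynomials `C = a + b x + d x y`), the condition imposed by a pair
`(j,k)` of branch points with sign `ε ∈ {±1}` (`w = u²`) is the row `(u_k − ε u_j, u_k w_j − ε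
u_j w_k, (u_k − ε u_j) w_j w_k)` against `(a, b, d)`. This file kernel-checks: (1) that row
equals `(u_k − ε u_j) · (1, −μ, μ²)` with `μ = ε u_j u_k` the SIGNED product (two polynomial
identities using `ε² = 1`); (2) the determinant of three rows `c_i · (1, −μ_i, μ_i²)` is
`−c₁c₂c₃ · (μ₂−μ₁)(μ₃−μ₁)(μ₃−μ₂)` (scaled Vandermonde); (3) hence the determinant of the three
pair rows is minus the product of the three factors `u_k − ε u_j` times the Vandermonde of the
signed products, for all eight sign patterns — the identity found by machine on another seat
(941 192 grid evaluations) and proved in three lines in the pen's note; (4) so the matrix is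
singular as soon as two signed products coincide (the rank drop). The geometric reading is NOT
formalised here.  Nothing here bears on HC / HC_CM / HC_AV.  No definitions: every statement is
a closed identity over ℚ.
-/

namespace Summit.Ventures.HSemireg.NodalPrymTangentRankS3

/-- Second entry of a pair row: `u_k w_j − ε u_j w_k = −μ (u_k − ε u_j)`, `w = u²`,
`μ = ε u_j u_k`, for `ε² = 1`. -/
theorem pair_row_entry_two (p q e : ℚ) (he : e * e = 1) :
    q * p ^ 2 - e * p * q ^ 2 = -(e * p * q) * (q - e * p) := by
  linear_combination (-(p ^ 2 * q)) * he

/-- Third entry of a pair row: `(u_k − ε u_j) w_j w_k = (u_k − ε u_j) μ²`. -/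
theorem pair_row_entry_three (p q e : ℚ) (he : e * e = 1) :
    (q - e * p) * p ^ 2 * q ^ 2 = (q - e * p) * (e * p * q) ^ 2 := by
  linear_combination (-((q - e * p) * p ^ 2 * q ^ 2)) * he

/-- Scaled Vandermonde: rows `c_i · (1, −μ_i, μ_i²)`. -/
theorem det_scaled_vandermonde (c₁ c₂ c₃ m₁ m₂ m₃ : ℚ) :
    Matrix.det !![c₁, -(c₁ * m₁), c₁ * m₁ ^ 2;
                 c₂, -(c₂ * m₂), c₂ * m₂ ^ 2;
                 c₃, -(c₃ * m₃), c₃ * m₃ ^ 2]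
      = -(c₁ * c₂ * c₃) * ((m₂ - m₁) * (m₃ - m₁) * (m₃ - m₂)) := by
  simp [Matrix.det_fin_three]
  ring

/-- The pair-condition matrix of a matching `(j₁k₁)(j₂k₂)(j₃k₃)` with signs `eᵢ ∈ {±1}`,
`pᵢ = u_{jᵢ}`, `qᵢ = u_{kᵢ}`, has determinant
`−∏ᵢ (qᵢ − eᵢ pᵢ) · Vandermonde(μ₁, μ₂, μ₃)` with `μᵢ = eᵢ pᵢ qᵢ`. -/
theorem det_pair_matrix (p₁ q₁ p₂ q₂ p₃ q₃ e₁ e₂ e₃ : ℚ)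
    (h₁ : e₁ = 1 ∨ e₁ = -1) (h₂ : e₂ = 1 ∨ e₂ = -1)
    (h₃ : e₃ = 1 ∨ e₃ = -1) :
    Matrix.det
        !![q₁ - e₁ * p₁, q₁ * p₁ ^ 2 - e₁ * p₁ * q₁ ^ 2,
             (q₁ - e₁ * p₁) * p₁ ^ 2 * q₁ ^ 2;
           q₂ - e₂ * p₂, q₂ * p₂ ^ 2 - e₂ * p₂ * q₂ ^ 2,
             (q₂ - e₂ * p₂) * p₂ ^ 2 * q₂ ^ 2;
           q₃ - e₃ * p₃, q₃ * p₃ ^ 2 - e₃ * p₃ * q₃ ^ 2,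
             (q₃ - e₃ * p₃) * p₃ ^ 2 * q₃ ^ 2]
      = -((q₁ - e₁ * p₁) * (q₂ - e₂ * p₂) * (q₃ - e₃ * p₃)) *
          ((e₂ * p₂ * q₂ - e₁ * p₁ * q₁) * (e₃ * p₃ * q₃ - e₁ * p₁ * q₁) *
            (e₃ * p₃ * q₃ - e₂ * p₂ * q₂)) := by
  rcases h₁ with rfl | rfl <;> rcases h₂ with rfl | rfl <;> rcases h₃ with rfl | rfl <;>
    simp [Matrix.det_fin_three] <;> ring

/-- Corollary (the drop): if two signed products coincide, the pair-condition matrix is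
singular — the nodal–Prym tangent span at `s = 3` then has rank at most 8. -/
theorem det_pair_matrix_eq_zero_of_eq (p₁ q₁ p₂ q₂ p₃ q₃ e₁ e₂ e₃ : ℚ)
    (h₁ : e₁ = 1 ∨ e₁ = -1) (h₂ : e₂ = 1 ∨ e₂ = -1)
    (h₃ : e₃ = 1 ∨ e₃ = -1) (h : e₁ * p₁ * q₁ = e₂ * p₂ * q₂) :
    Matrix.det
        !![q₁ - e₁ * p₁, q₁ * p₁ ^ 2 - e₁ * p₁ * q₁ ^ 2,
             (q₁ - e₁ * p₁) * p₁ ^ 2 * q₁ ^ 2;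
           q₂ - e₂ * p₂, q₂ * p₂ ^ 2 - e₂ * p₂ * q₂ ^ 2,
             (q₂ - e₂ * p₂) * p₂ ^ 2 * q₂ ^ 2;
           q₃ - e₃ * p₃, q₃ * p₃ ^ 2 - e₃ * p₃ * q₃ ^ 2,
             (q₃ - e₃ * p₃) * p₃ ^ 2 * q₃ ^ 2]
      = 0 := by
  rw [det_pair_matrix p₁ q₁ p₂ q₂ p₃ q₃ e₁ e₂ e₃ h₁ h₂ h₃, h]
  ring

end Summit.Ventures.HSemireg.NodalPrymTangentRankS3
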